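import Mathlib
import HarnessLib

/-!
# Non-square descent — NORM ELEMENTS OF THE CYCLIC `p`-TOWER (stub S3 (b) and the index hypothesis `N∘ι = p` of stub S2 of the line
# card `nonsquare-descent`) for the seed crux `SignedMuSeedAtTwoPlus` stmt-BirchSwinnertonDyer-21438 (parent Kμ⁺ `SignedMuVanishingAtTwoPlus`
# stmt-BirchSwinnertonDyer-20689, route ResidualThetaTransportAtTwo)

Cell `bsd-wall`, width seat `bsd-wall-rtt-p4-w2` g17 (`--supports`, closes nothing).  THEOREMS ONLY; BSD is not proved by this: the
statements are identities in an arbitrary commutative ring `A` (informally `Λ' = 𝒪⟦T⟧` or `Λ'/2 = 𝔽₄⟦T⟧`) for an element `γ`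
(informally `γ = 1 + T`, the topological generator), the level elements `ω(q) = γ^q − 1` (`q = pⁿ`: `ω_n`) and the norm elements
`ν(q, c) = ∑_{i<c} γ^{q i}` (`c = p^{m−n}`: `ν_{m,n} = N_{G_{m,n}}`, the norm of `Gal(M_m/M_n)` as an element of `𝒪[G_m] = Λ'/ω_m`).

* §1 `pow_mul_sub_one_eq_geom_sum_mul` — **`ω_m = ν_{m,n} · ω_n`**: `γ^{q c} − 1 = (∑_{i<c} γ^{q i}) (γ^q − 1)` (Mathlib `geom_sum_mul`);
  `sub_one_dvd_geom_sum_sub_natCast` — **`ν_{m,n} ≡ [M_m : M_n] (mod ω_n)`**: `γ^q − 1 ∣ (∑_{i<c} γ^{q i}) − c`;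
  `geom_sum_smul_eq_natCast_smul` — hence on an `ω_n`-torsion element the norm element acts as the INDEX: `ν • e = c • e`.  This is the
  hypothesis `hNι : N k (ι k y) = c • y` (`c = p`) of the S2 engine `coherent_torsion_eq_zero` (`Theorems/…NonsquareDescentEngine.lean`):
  norm after inclusion `B'_n ↪ B'_{n+1}` is multiplication by `[M_{n+1} : M_n] = p`.
* §2 characteristic `p` (`[CharP A p]`, informally `A = Λ'/p`-modules such as `𝓔^χ/2`): `geom_sum_eq_sub_one_pow_of_charP` —
  `∑_{i<p} x^i = (x − 1)^{p−1}` (the cyclotomic polynomial `Φ_p = (X−1)^{p−1}` mod `p`, Mathlib `cyclotomic_mul_prime_eq_pow_of_not_dvd`);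
  `one_add_pow_prime_pow_sub_one_of_charP` — **`ω_n ≡ T^{pⁿ} (mod p)`**; `geom_sum_one_add_pow_eq_pow_of_charP` —
  **`ν_{n+1,n} ≡ T^{pⁿ(p−1)} (mod p)`**, at `p = 2`: `one_add_one_add_pow_eq_pow_of_charTwo` — **`ν_{n+1,n} = 1 + γ^{2ⁿ} ≡ T^{2ⁿ} (mod 2)`**,
  the card's input (b) of stub S3 («`N_{G_{n+1,n}} ≡ (γ−1)^{2ⁿ} mod 2`»), i.e. the hypothesis `hN : ι n (N n v) = x^{d n} • v` of the
  squares-dichotomy engine with `x = T`, `d n = 2ⁿ` (`geom_sum_one_add_pow_smul_of_charTwo`).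

[folklore]
-/

set_option autoImplicit false
-- the Theorems namespace of this sub repeats the summit name by design (D-0017 nested layout)
set_option linter.dupNamespace false

open Finset Polynomial

namespace Summit.BirchSwinnertonDyer.BirchSwinnertonDyer.Theorems.SignedMuAtTwo.NonsquareDescent

/-! ## §1 `ω_m = ν ω_n` and `ν ≡ index (mod ω_n)` -/

section AnyRing

variable {A : Type*} [CommRing A]

/-- **`ω_m = ν_{m,n} ω_n`**: `γ^{q c} − 1 = (∑_{i<c} γ^{q i}) · (γ^q − 1)`. [folklore] -/
theorem pow_mul_sub_one_eq_geom_sum_mul (γ : A) (q c : ℕ) :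
    γ ^ (q * c) - 1 = (∑ i ∈ range c, γ ^ (q * i)) * (γ ^ q - 1) := by
  rw [pow_mul, ← geom_sum_mul]
  simp_rw [← pow_mul]

/-- **`ν_{m,n} ≡ c (mod ω_n)`** where `c = [M_m : M_n]` is the number of terms: `γ^q − 1 ∣ (∑_{i<c} γ^{q i}) − c`
(each `γ^{q i} − 1` is divisible by `γ^q − 1`). [folklore] -/
theorem sub_one_dvd_geom_sum_sub_natCast (γ : A) (q c : ℕ) :
    γ ^ q - 1 ∣ (∑ i ∈ range c, γ ^ (q * i)) - c := by
  have hc : (c : A) = ∑ i ∈ range c, (1 : A) := by simp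
  rw [hc, ← sum_sub_distrib]
  exact dvd_sum fun i _ => pow_one_sub_dvd_pow_mul_sub_one γ q i

/-- **The norm acts as the index on invariants**: if `(γ^q − 1) • e = 0` (an `ω_n`-torsion element, e.g. anything coming from
level `n`) then `(∑_{i<c} γ^{q i}) • e = c • e` — «norm after inclusion is multiplication by `[M_m : M_n]`», hypothesis `hNι` of
the S2 engine. [folklore] -/
theorem geom_sum_smul_eq_natCast_smul {E : Type*} [AddCommGroup E] [Module A E] (γ : A) (q c : ℕ) {e : E}
    (he : (γ ^ q - 1) • e = 0) :
    (∑ i ∈ range c, γ ^ (q * i)) • e = (c : A) • e := by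
  obtain ⟨r, hr⟩ := sub_one_dvd_geom_sum_sub_natCast γ q c
  rw [← sub_eq_zero, ← sub_smul, hr, mul_comm, mul_smul, he, smul_zero]

/-- Variant of `geom_sum_smul_eq_natCast_smul` with the natural-number scalar `c • e`. [folklore] -/
theorem geom_sum_smul_eq_nsmul {E : Type*} [AddCommGroup E] [Module A E] (γ : A) (q c : ℕ) {e : E}
    (he : (γ ^ q - 1) • e = 0) :
    (∑ i ∈ range c, γ ^ (q * i)) • e = c • e := by
  rw [geom_sum_smul_eq_natCast_smul γ q c he, Nat.cast_smul_eq_nsmul]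

end AnyRing

/-! ## §2 Characteristic `p`: `ω_n ≡ T^{pⁿ}` and `ν_{n+1,n} ≡ T^{pⁿ(p−1)}` -/

section CharP

variable {A : Type*} [CommRing A] (p : ℕ) [hp : Fact p.Prime] [CharP A p]

/-- In characteristic `p`: `∑_{i<p} x^i = (x − 1)^{p−1}` (the `p`-th cyclotomic polynomial is `(X − 1)^{p−1}` modulo `p`). [folklore] -/
theorem geom_sum_eq_sub_one_pow_of_charP (x : A) :
    ∑ i ∈ range p, x ^ i = (x - 1) ^ (p - 1) := by
  have h1 : ¬ p ∣ 1 := fun h => hp.out.ne_one (Nat.dvd_one.mp h)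
  have hcyc : cyclotomic p A = (X - 1 : A[X]) ^ (p - 1) := by
    have h := cyclotomic_mul_prime_eq_pow_of_not_dvd A h1
    rwa [one_mul, cyclotomic_one] at h
  have heval := congr_arg (Polynomial.eval x) hcyc
  rw [cyclotomic_prime, eval_finsetSum] at heval
  simp only [eval_pow, eval_X, eval_sub, eval_one] at heval
  exact heval

/-- **`ω_n ≡ T^{pⁿ} (mod p)`**: in characteristic `p`, `(1 + T)^{pⁿ} − 1 = T^{pⁿ}`. [folklore] -/
theorem one_add_pow_prime_pow_sub_one_of_charP (T : A) (n : ℕ) :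
    (1 + T) ^ p ^ n - 1 = T ^ p ^ n := by
  rw [add_pow_char_pow (p := p), one_pow, add_sub_cancel_left]

/-- **`ν_{n+1,n} ≡ T^{pⁿ(p−1)} (mod p)`**: in characteristic `p`, with `γ = 1 + T`,
`∑_{i<p} γ^{pⁿ i} = T^{pⁿ (p−1)}`. [folklore] -/
theorem geom_sum_one_add_pow_eq_pow_of_charP (T : A) (n : ℕ) :
    ∑ i ∈ range p, (1 + T) ^ (p ^ n * i) = T ^ (p ^ n * (p - 1)) := by
  simp_rw [pow_mul]
  rw [geom_sum_eq_sub_one_pow_of_charP p, one_add_pow_prime_pow_sub_one_of_charP p]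

end CharP

/-! ## §3 Characteristic `2`: `ν_{n+1,n} = 1 + γ^{2ⁿ} ≡ T^{2ⁿ}` -/

section CharTwo

variable {A : Type*} [CommRing A] [CharP A 2]

/-- **Input (b) of stub S3 at `p = 2`**: in characteristic `2`, `1 + (1 + T)^{2ⁿ} = T^{2ⁿ}` — the norm element `N_{G_{n+1,n}} = 1 + γ^{2ⁿ}`
of the quadratic step `M_{n+1}/M_n` acts on `𝓔^χ/2` as `(γ − 1)^{2ⁿ} = T^{2ⁿ}`. [folklore] -/
theorem one_add_one_add_pow_eq_pow_of_charTwo (T : A) (n : ℕ) :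
    1 + (1 + T) ^ 2 ^ n = T ^ 2 ^ n := by
  haveI : Fact (Nat.Prime 2) := ⟨Nat.prime_two⟩
  have h := geom_sum_one_add_pow_eq_pow_of_charP (A := A) 2 T n
  rw [Finset.sum_range_succ, Finset.sum_range_one, mul_zero, pow_zero, mul_one,
    show (2 : ℕ) - 1 = 1 from rfl, mul_one] at h
  exact h

/-- The same as the hypothesis `hN : ι n (N n v) = x ^ (d n) • v` of the squares-dichotomy engine (`x = T`, `d n = 2ⁿ`): on a module
over a ring of characteristic `2`, the norm element `1 + γ^{2ⁿ}` acts as `T^{2ⁿ}`. [folklore] -/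
theorem geom_sum_one_add_pow_smul_of_charTwo {V : Type*} [AddCommGroup V] [Module A V] (T : A) (n : ℕ) (v : V) :
    (1 + (1 + T) ^ 2 ^ n) • v = T ^ 2 ^ n • v := by
  rw [one_add_one_add_pow_eq_pow_of_charTwo]

end CharTwo

end Summit.BirchSwinnertonDyer.BirchSwinnertonDyer.Theorems.SignedMuAtTwo.NonsquareDescent
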